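import Mathlib
import Literature.Computability.AlgebraicComplexity.NestFreeMatchingPoly
import HarnessLib

/-!
# Route FifoMatching — crux `NNLinearDegreeCofactorHard` (stmt-ValiantsHypothesis-23918), line
# `internal_cofactor`, stub S2b: `R`-AVOIDING NEST-FREE PERFECT MATCHINGS EXIST

On the registered line `Cruxes/NNLinearDegreeCofactorHard/Lines/internal_cofactor.lean` the open stub
S2b (`stub_denseInternalHard`) concerns `NN_n · p` for an INTERNAL cofactor `p` on a defect set
`R ⊆ [2n]`.  The cofactor-removal step of the cell (grade the arc variables by `w_R = 0` on `R × R`,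
`1` elsewhere; the top `w_R`-component of `NN_n` is the arc polynomial `P_R` of the nest-free perfect
matchings with NO arc inside `R`, and `L₊(P_R) ≤ L₊(NN_n · p) + O(1)`) and every excision cut need
the purely combinatorial fact proved here:

* `exists_nestFree_avoiding` — for every `R ⊆ [2n]` with `|R| ≤ n` there is a nest-free (FIFO)
  perfect matching `M` of `[2n]` with `M r ∉ R` for all `r ∈ R`;
  `avoiding_nonempty` — the same as non-emptiness of the filtered family.

Proof (two minimisations, no recursion).  (1) Among all perfect matchings of `[2n]` (`Fin.rev` is
one) take one with the fewest `R`-vertices matched into `R`; if some arc `{r, r'}` lies inside `R`,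
then, as `|Rᶜ| = 2n − |R| ≥ n ≥ |R| > |R ∖ {r, r'}|`, the injective `M` cannot map `Rᶜ` into
`R ∖ {r, r'}`, so some arc `{s, s'}` lies inside `Rᶜ`, and exchanging partners (`{r', s'}, {s, r}`:
conjugation of `M` by the transposition `(r' s)`) lowers the count (`exists_fewer_defect_arcs`).
(2) Among the `R`-avoiding perfect matchings take one of least energy `E(M) = Σ_x (M x − x)²`; a
nesting `a < b < M b < M a` is resolved by SPLIT `{a, b}, {M b, M a}` or CROSS `{a, M b}, {b, M a}` —
one of the two is always `R`-avoiding — and both lower the energy by the identity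
`E(τ M τ) = E(M) − 4 (v − u)(M u − M v)` for the transposition `τ = (u v)` (`energy_conj`,
`exists_lower_energy`).  §1 is the bookkeeping of partner exchange.

Honest framing: a helper (`--supports`) for ONE stub of an OPEN crux on the conditional route
`FifoMatching`; nothing here proves S2b, the crux, `NNDivisionHard`, `NNNotVP` or VP ≠ VNP, and
monotone ≠ general (`Literature.Barriers.ValiantsHypothesis.MonotoneGap`).  No definitions, no named
facts.
-/

noncomputable section

-- Sub = Summit single-conjunct layout: the duplicated namespace component is mandated by the tree.
set_option linter.dupNamespace false

namespace Summit.ValiantsHypothesis.ValiantsHypothesis.Theorems.FifoMatching.NNLinearDegreeCofactorHard.AvoidingMatchings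

open Finset Literature.Computability.AlgebraicComplexity

variable {m : ℕ}

/-! ### §1 Exchanging the partners of two vertices (conjugation by a transposition) -/

/-- Conjugating a perfect matching by a transposition gives a perfect matching. [folklore] -/
theorem conj_mem_perfectMatchings {M : Fin m → Fin m} (hM : M ∈ perfectMatchings m) (u v : Fin m) :
    (fun x => Equiv.swap u v (M (Equiv.swap u v x))) ∈ perfectMatchings m := by
  obtain ⟨hinv, hfp⟩ := mem_perfectMatchings.1 hM
  refine mem_perfectMatchings.2 ⟨fun x => ?_, fun x => ?_⟩
  · simp only [Equiv.swap_apply_self, hinv]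
  · intro h
    have h' := congrArg (Equiv.swap u v) h
    simp only [Equiv.swap_apply_self] at h'
    exact hfp _ h'

section Conj

variable {M : Fin m → Fin m} {u v : Fin m}

/-- After exchanging partners, `u` is matched to the old partner of `v`. [folklore] -/
theorem conj_apply_left (hM : M ∈ perfectMatchings m) (hMu : M u ≠ v) :
    Equiv.swap u v (M (Equiv.swap u v u)) = M v := by
  obtain ⟨hinv, hfp⟩ := mem_perfectMatchings.1 hM
  rw [Equiv.swap_apply_left]
  exact Equiv.swap_apply_of_ne_of_ne (fun h => hMu (by rw [← h, hinv])) (hfp v)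

/-- After exchanging partners, `v` is matched to the old partner of `u`. [folklore] -/
theorem conj_apply_right (hM : M ∈ perfectMatchings m) (hMu : M u ≠ v) :
    Equiv.swap u v (M (Equiv.swap u v v)) = M u := by
  obtain ⟨-, hfp⟩ := mem_perfectMatchings.1 hM
  rw [Equiv.swap_apply_right]
  exact Equiv.swap_apply_of_ne_of_ne (hfp u) hMu

/-- After exchanging partners, the old partner of `u` is matched to `v`. [folklore] -/
theorem conj_apply_partner_left (hM : M ∈ perfectMatchings m) (hMu : M u ≠ v) :
    Equiv.swap u v (M (Equiv.swap u v (M u))) = v := by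
  obtain ⟨hinv, hfp⟩ := mem_perfectMatchings.1 hM
  rw [Equiv.swap_apply_of_ne_of_ne (hfp u) hMu, hinv, Equiv.swap_apply_left]

/-- After exchanging partners, the old partner of `v` is matched to `u`. [folklore] -/
theorem conj_apply_partner_right (hM : M ∈ perfectMatchings m) (hMu : M u ≠ v) :
    Equiv.swap u v (M (Equiv.swap u v (M v))) = u := by
  obtain ⟨hinv, hfp⟩ := mem_perfectMatchings.1 hM
  have hMv : M v ≠ u := fun h => hMu (by rw [← h, hinv])
  rw [Equiv.swap_apply_of_ne_of_ne hMv (hfp v), hinv, Equiv.swap_apply_right]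

/-- All other arcs are unchanged. [folklore] -/
theorem conj_apply_of_ne (hM : M ∈ perfectMatchings m) {x : Fin m} (hxu : x ≠ u) (hxv : x ≠ v)
    (hxMu : x ≠ M u) (hxMv : x ≠ M v) : Equiv.swap u v (M (Equiv.swap u v x)) = M x := by
  obtain ⟨hinv, -⟩ := mem_perfectMatchings.1 hM
  rw [Equiv.swap_apply_of_ne_of_ne hxu hxv]
  exact Equiv.swap_apply_of_ne_of_ne (fun h => hxMu (by rw [← h, hinv]))
    (fun h => hxMv (by rw [← h, hinv]))

/-- **Exchanging partners keeps `R`-avoidance when the two new arcs are not `R–R`.** [folklore] -/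
theorem conj_avoids {R : Finset (Fin m)} (hM : M ∈ perfectMatchings m) (hMu : M u ≠ v)
    (hfree : ∀ i ∈ R, M i ∉ R) (h1 : ¬ (u ∈ R ∧ M v ∈ R)) (h2 : ¬ (v ∈ R ∧ M u ∈ R)) :
    ∀ i ∈ R, Equiv.swap u v (M (Equiv.swap u v i)) ∉ R := by
  intro i hi
  by_cases hiu : i = u
  · subst hiu; rw [conj_apply_left hM hMu]; exact fun h => h1 ⟨hi, h⟩
  by_cases hiv : i = v
  · subst hiv; rw [conj_apply_right hM hMu]; exact fun h => h2 ⟨hi, h⟩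
  by_cases hiMu : i = M u
  · subst hiMu; rw [conj_apply_partner_left hM hMu]; exact fun h => h2 ⟨h, hi⟩
  by_cases hiMv : i = M v
  · subst hiMv; rw [conj_apply_partner_right hM hMu]; exact fun h => h1 ⟨h, hi⟩
  rw [conj_apply_of_ne hM hiu hiv hiMu hiMv]
  exact hfree i hi

/-- **The energy identity.**  With `E(M) := Σ_x (M x − x)²`, exchanging the partners of `u ≠ v`
(not partners of each other) changes the energy by `E(M') = E(M) − 4 (v − u) (M u − M v)`: only the
four vertices `u, v, M u, M v` contribute differently. [folklore] -/
theorem energy_conj (hM : M ∈ perfectMatchings m) (huv : u ≠ v) (hMu : M u ≠ v) :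
    ∑ x : Fin m, (((Equiv.swap u v (M (Equiv.swap u v x)) : Fin m) : ℤ) - (x : ℤ)) ^ 2
      + 4 * ((v : ℤ) - (u : ℤ)) * (((M u : Fin m) : ℤ) - ((M v : Fin m) : ℤ))
      = ∑ x : Fin m, (((M x : Fin m) : ℤ) - (x : ℤ)) ^ 2 := by
  classical
  obtain ⟨hinv, hfp⟩ := mem_perfectMatchings.1 hM
  have hMv : M v ≠ u := fun h => hMu (by rw [← h, hinv])
  have hMuMv : M u ≠ M v := fun h => huv (by rw [← hinv u, h, hinv])
  set τ := Equiv.swap u v with hτ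
  -- reindex the new energy by `τ`
  have hre : ∑ x : Fin m, (((τ (M (τ x)) : Fin m) : ℤ) - (x : ℤ)) ^ 2 =
      ∑ y : Fin m, (((τ (M y) : Fin m) : ℤ) - ((τ y : Fin m) : ℤ)) ^ 2 := by
    rw [← Equiv.sum_comp τ (fun x => (((τ (M (τ x)) : Fin m) : ℤ) - (x : ℤ)) ^ 2)]
    simp only [hτ, Equiv.swap_apply_self]
  rw [hre]
  -- the four special vertices
  set T : Finset (Fin m) := insert u (insert v (insert (M u) {M v})) with hT
  have hu : u ∉ insert v (insert (M u) ({M v} : Finset (Fin m))) := by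
    simp only [mem_insert, mem_singleton, not_or]
    exact ⟨huv, (hfp u).symm, hMv.symm⟩
  have hv : v ∉ insert (M u) ({M v} : Finset (Fin m)) := by
    simp only [mem_insert, mem_singleton, not_or]
    exact ⟨hMu.symm, (hfp v).symm⟩
  have hMu' : M u ∉ ({M v} : Finset (Fin m)) := by
    simp only [mem_singleton]; exact hMuMv
  -- off `T` the terms agree
  have key : ∀ y ∈ Tᶜ, (((τ (M y) : Fin m) : ℤ) - ((τ y : Fin m) : ℤ)) ^ 2 =
      (((M y : Fin m) : ℤ) - (y : ℤ)) ^ 2 := by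
    intro y hy
    rw [mem_compl, hT] at hy
    simp only [mem_insert, mem_singleton, not_or] at hy
    obtain ⟨h1, h2, h3, h4⟩ := hy
    have hy' : τ y = y := Equiv.swap_apply_of_ne_of_ne h1 h2
    have hMy1 : M y ≠ u := fun h => h3 (by rw [← h, hinv])
    have hMy2 : M y ≠ v := fun h => h4 (by rw [← h, hinv])
    rw [hy', show τ (M y) = M y from Equiv.swap_apply_of_ne_of_ne hMy1 hMy2]
  rw [← sum_add_sum_compl T (fun y => (((τ (M y) : Fin m) : ℤ) - ((τ y : Fin m) : ℤ)) ^ 2),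
    ← sum_add_sum_compl T (fun y => (((M y : Fin m) : ℤ) - (y : ℤ)) ^ 2), sum_congr rfl key]
  -- the four special terms
  have hτu : τ u = v := Equiv.swap_apply_left u v
  have hτv : τ v = u := Equiv.swap_apply_right u v
  have hτMu : τ (M u) = M u := Equiv.swap_apply_of_ne_of_ne (hfp u) hMu
  have hτMv : τ (M v) = M v := Equiv.swap_apply_of_ne_of_ne hMv (hfp v)
  rw [hT, sum_insert hu, sum_insert hv, sum_insert hMu', sum_singleton,
    sum_insert hu, sum_insert hv, sum_insert hMu', sum_singleton]
  rw [hinv u, hinv v, hτu, hτv, hτMu, hτMv]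
  ring

end Conj

/-! ### §2 Removing `R–R` arcs -/

/-- **An `R–R` arc can be traded away when `|R| ≤ n`.**  If a perfect matching `M` of `[2n]` has an
arc inside `R`, `|R| ≤ n`, then (counting: `M` cannot map all of `Rᶜ`, `|Rᶜ| ≥ n`, into
`R ∖ {r, M r}`) some arc lies inside `Rᶜ`, and exchanging partners between the two arcs gives a perfect
matching with fewer `R`-vertices matched into `R`. [folklore] -/
theorem exists_fewer_defect_arcs {n : ℕ} {R : Finset (Fin (2 * n))} (hR : R.card ≤ n)
    {M : Fin (2 * n) → Fin (2 * n)} (hM : M ∈ perfectMatchings (2 * n)) (hbad : ∃ r ∈ R, M r ∈ R) :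
    ∃ M' ∈ perfectMatchings (2 * n),
      (R.filter fun i => M' i ∈ R).card < (R.filter fun i => M i ∈ R).card := by
  classical
  obtain ⟨hinv, hfp⟩ := mem_perfectMatchings.1 hM
  obtain ⟨r, hr, hMr⟩ := hbad
  -- an arc inside `Rᶜ`
  have hgood : ∃ s, s ∉ R ∧ M s ∉ R := by
    by_contra hcon
    push Not at hcon
    have hmaps : ∀ s ∈ Rᶜ, M s ∈ (R.erase r).erase (M r) := by
      intro s hs
      rw [mem_compl] at hs
      refine mem_erase.2 ⟨fun h => hs ?_, mem_erase.2 ⟨fun h => hs ?_, hcon s hs⟩⟩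
      · rw [← hinv s, h, hinv]; exact hr
      · rw [← hinv s, h]; exact hMr
    have hinj : Set.InjOn M (Rᶜ : Finset (Fin (2 * n))) :=
      fun a _ b _ hab => by rw [← hinv a, hab, hinv]
    have hle := card_le_card_of_injOn M hmaps hinj
    have hMr' : M r ∈ R.erase r := mem_erase.2 ⟨hfp r, hMr⟩
    rw [card_erase_of_mem hMr', card_erase_of_mem hr, card_compl, Fintype.card_fin] at hle
    have h2 : 2 ≤ R.card := by
      have : ({r, M r} : Finset (Fin (2 * n))) ⊆ R := by
        intro x hx
        simp only [mem_insert, mem_singleton] at hx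
        rcases hx with rfl | rfl
        · exact hr
        · exact hMr
      have hc := card_le_card this
      rw [card_pair (hfp r).symm] at hc
      exact hc
    omega
  obtain ⟨s, hs, hMs⟩ := hgood
  -- exchange partners of `M r` and `s`: new arcs `{M r, M s}` and `{s, r}`
  have hne : M (M r) ≠ s := by rw [hinv]; exact fun h => hs (h ▸ hr)
  refine ⟨fun x => Equiv.swap (M r) s (M (Equiv.swap (M r) s x)),
    conj_mem_perfectMatchings hM (M r) s, ?_⟩
  apply card_lt_card
  refine ⟨fun i hi => ?_, fun hsub => ?_⟩
  · rw [mem_filter] at hi ⊢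
    obtain ⟨hiR, hiM⟩ := hi
    dsimp only at hiM
    refine ⟨hiR, ?_⟩
    by_cases hiu : i = M r
    · exfalso
      rw [hiu, conj_apply_left hM hne] at hiM
      exact hMs hiM
    by_cases hiv : i = s
    · exact absurd (hiv ▸ hiR) hs
    by_cases hiMu : i = M (M r)
    · exfalso
      rw [hiMu, conj_apply_partner_left hM hne] at hiM
      exact hs hiM
    by_cases hiMv : i = M s
    · exact absurd (hiMv ▸ hiR) hMs
    rwa [conj_apply_of_ne hM hiu hiv hiMu hiMv] at hiM
  · have hrmem : r ∈ R.filter fun i => M i ∈ R := mem_filter.2 ⟨hr, hMr⟩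
    have h := (mem_filter.1 (hsub hrmem)).2
    dsimp only at h
    have hrs : r ≠ s := fun h' => hs (by rw [← h']; exact hr)
    rw [Equiv.swap_apply_of_ne_of_ne (hfp r).symm hrs, Equiv.swap_apply_left] at h
    exact hs h

/-! ### §3 Resolving a nesting -/

/-- **A nesting can be resolved inside the `R`-avoiding perfect matchings, lowering the energy.**
If `M` avoids `R × R` and has a nesting `a < b < M b < M a`, then exchanging partners — SPLIT
`{a, b}, {M b, M a}` if one of the crossing pairs `{a, M b}`, `{b, M a}` is `R–R`, else CROSS
`{a, M b}, {b, M a}` — gives an `R`-avoiding perfect matching of strictly smaller energy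
`Σ_x (M x − x)²` (by `energy_conj`, the drop is `4 (M a − b)(M b − a)`, resp.
`4 (M a − M b)(b − a)`). [folklore] -/
theorem exists_lower_energy {R : Finset (Fin m)} {M : Fin m → Fin m}
    (hM : M ∈ perfectMatchings m) (hfree : ∀ i ∈ R, M i ∉ R) (hnest : M ∉ nestFreeMatchings m) :
    ∃ M' ∈ perfectMatchings m, (∀ i ∈ R, M' i ∉ R) ∧
      ∑ x : Fin m, (((M' x : Fin m) : ℤ) - (x : ℤ)) ^ 2 <
        ∑ x : Fin m, (((M x : Fin m) : ℤ) - (x : ℤ)) ^ 2 := by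
  classical
  obtain ⟨hinv, hfp⟩ := mem_perfectMatchings.1 hM
  have hnest' : ∃ a b, a < b ∧ b < M b ∧ M b < M a := by
    by_contra hcon
    exact hnest (mem_nestFreeMatchings.2 ⟨hM, fun i j hij hj hji => hcon ⟨i, j, hij, hj, hji⟩⟩)
  obtain ⟨a, b, hab, hbc, hcd⟩ := hnest'
  -- the nesting: a < b < c := M b < d := M a
  have hba : (a : ℤ) < b := by exact_mod_cast hab
  have hcb : (b : ℤ) < ((M b : Fin m) : ℤ) := by exact_mod_cast hbc
  have hdc : (((M b : Fin m) : ℤ)) < ((M a : Fin m) : ℤ) := by exact_mod_cast hcd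
  -- no old arc is `R–R`
  have hRad : ¬ (a ∈ R ∧ M a ∈ R) := fun h => hfree a h.1 h.2
  have hRbc : ¬ (b ∈ R ∧ M b ∈ R) := fun h => hfree b h.1 h.2
  by_cases hsplit : (a ∈ R ∧ M b ∈ R) ∨ (b ∈ R ∧ M a ∈ R)
  · -- SPLIT: exchange partners of `u := b` and `v := M a`: new arcs `{b, a}` and `{M a, M b}`
    have huv : b ≠ M a := fun h => by
      have : (b : ℤ) = ((M a : Fin m) : ℤ) := by rw [h]
      linarith
    have hMu : M b ≠ M a := fun h => by
      have : ((M b : Fin m) : ℤ) = ((M a : Fin m) : ℤ) := by rw [h]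
      linarith
    refine ⟨fun x => Equiv.swap b (M a) (M (Equiv.swap b (M a) x)),
      conj_mem_perfectMatchings hM b (M a), ?_, ?_⟩
    · refine conj_avoids hM hMu hfree ?_ ?_
      · rw [hinv]
        rintro ⟨hb, ha⟩
        rcases hsplit with ⟨ha', hc⟩ | ⟨-, hd⟩
        · exact hRbc ⟨hb, hc⟩
        · exact hRad ⟨ha, hd⟩
      · rintro ⟨hd, hc⟩
        rcases hsplit with ⟨ha, -⟩ | ⟨hb, -⟩
        · exact hRad ⟨ha, hd⟩
        · exact hRbc ⟨hb, hc⟩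
    · have e := energy_conj hM huv hMu
      rw [hinv] at e
      nlinarith [mul_pos (sub_pos.2 (hcb.trans hdc)) (sub_pos.2 (hba.trans hcb))]
  · -- CROSS: exchange partners of `u := M b` and `v := M a`: new arcs `{M b, a}` and `{M a, b}`
    obtain ⟨hs1, hs2⟩ := not_or.1 hsplit
    have huv : M b ≠ M a := fun h => by
      have : ((M b : Fin m) : ℤ) = ((M a : Fin m) : ℤ) := by rw [h]
      linarith
    have hMu : M (M b) ≠ M a := fun h => by
      rw [hinv] at h
      have : (b : ℤ) = ((M a : Fin m) : ℤ) := by rw [h]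
      linarith
    refine ⟨fun x => Equiv.swap (M b) (M a) (M (Equiv.swap (M b) (M a) x)),
      conj_mem_perfectMatchings hM (M b) (M a), ?_, ?_⟩
    · refine conj_avoids hM hMu hfree ?_ ?_
      · rw [hinv]
        exact fun h => hs1 ⟨h.2, h.1⟩
      · rw [hinv]
        exact fun h => hs2 ⟨h.2, h.1⟩
    · have e := energy_conj hM huv hMu
      rw [hinv, hinv] at e
      nlinarith [mul_pos (sub_pos.2 hdc) (sub_pos.2 hba)]

/-! ### §4 Existence -/

/-- **`R`-avoiding nest-free perfect matchings exist whenever `|R| ≤ n`.**  For every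
`R ⊆ [2n]` with `|R| ≤ n` there is a nest-free (FIFO) perfect matching of `[2n]` none of whose arcs
has both endpoints in `R`.  Proof: among all perfect matchings (nonempty: `Fin.rev`) one with the
fewest `R`-vertices matched into `R` has none (`exists_fewer_defect_arcs`); among the `R`-avoiding
ones, one of least energy `Σ_x (M x − x)²` is nest-free (`exists_lower_energy`).  On the
`internal_cofactor` line this is what identifies the top `w_R`-component of `NN_n` with the arc
polynomial of the `R`-avoiding nest-free matchings (cofactor removal), and what every excision cut
needs on its interval. [folklore] -/
theorem exists_nestFree_avoiding {n : ℕ} (R : Finset (Fin (2 * n))) (hR : R.card ≤ n) :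
    ∃ M ∈ nestFreeMatchings (2 * n), ∀ i ∈ R, M i ∉ R := by
  classical
  -- a perfect matching of `[2n]`: `i ↦ i + n` / `i ↦ i − n`
  have hne : (perfectMatchings (2 * n)).Nonempty :=
    ⟨Fin.rev, mem_perfectMatchings.2 ⟨fun i => Fin.rev_rev i, fun i h => by
      have e := congrArg Fin.val h
      rw [Fin.val_rev] at e
      omega⟩⟩
  -- stage 1: fewest `R`-vertices matched into `R`
  obtain ⟨M₁, hM₁, hmin₁⟩ :=
    exists_min_image (perfectMatchings (2 * n)) (fun M => (R.filter fun i => M i ∈ R).card) hne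
  have hfree₁ : ∀ i ∈ R, M₁ i ∉ R := by
    by_contra hcon
    push Not at hcon
    obtain ⟨M', hM', hlt⟩ := exists_fewer_defect_arcs hR hM₁ hcon
    exact absurd (hmin₁ M' hM') (not_le.2 hlt)
  -- stage 2: least energy among the `R`-avoiding perfect matchings
  set S := (perfectMatchings (2 * n)).filter (fun M => ∀ i ∈ R, M i ∉ R) with hS
  have hSne : S.Nonempty := ⟨M₁, mem_filter.2 ⟨hM₁, hfree₁⟩⟩
  obtain ⟨M₂, hM₂, hmin₂⟩ := exists_min_image S
    (fun M => ∑ x : Fin (2 * n), (((M x : Fin (2 * n)) : ℤ) - (x : ℤ)) ^ 2) hSne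
  obtain ⟨hM₂pm, hfree₂⟩ := mem_filter.1 hM₂
  refine ⟨M₂, ?_, hfree₂⟩
  by_contra hnest
  obtain ⟨M', hM', hfree', hlt⟩ := exists_lower_energy hM₂pm hfree₂ hnest
  exact absurd (hmin₂ M' (mem_filter.2 ⟨hM', hfree'⟩)) (not_le.2 hlt)

/-- **The family of `R`-avoiding nest-free perfect matchings of `[2n]` is nonempty when
`|R| ≤ n`** (Finset form of `exists_nestFree_avoiding`). [folklore] -/
theorem avoiding_nonempty {n : ℕ} (R : Finset (Fin (2 * n))) (hR : R.card ≤ n) :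
    ((nestFreeMatchings (2 * n)).filter fun M => ∀ i ∈ R, M i ∉ R).Nonempty := by
  obtain ⟨M, hM, hfree⟩ := exists_nestFree_avoiding R hR
  exact ⟨M, mem_filter.2 ⟨hM, hfree⟩⟩

end Summit.ValiantsHypothesis.ValiantsHypothesis.Theorems.FifoMatching.NNLinearDegreeCofactorHard.AvoidingMatchings

end
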